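import Literature.Probability.Percolation.TrackExchangeTransport
import HarnessLib

/-!
# One block `U_k` of track exchanges: the envelope of the transported walk

Grimmett–Manolescu, *Bond percolation on isoradial graphs* (PTRF 159 (2014) 273–327 =
arXiv:1204.0505), §6.2, (6.8) `U_k = Σ_k ∘ Σ_{k+1} ∘ ⋯ ∘ Σ_{N+k-1}` ("`U_k` moves the track at
level `N+k-1` to level `k-1`, while raising the tracks at levels `k-1, …, N+k-2` by one level
each") and the proof of Lemma 6.6, first step (6.23)–(6.25): the ranges `L^j`, "obtained from
`L^j` by increasing its height in certain columns: for each primal vertex `v_{n,j}` contained in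
`L^j`, the heights in columns `n+1` and `n+2` increase to `j+1` and `j`", the claim
"`Ψ_j(γ)` is contained in `L^j`", and the column-additivity bound (6.25) ⇒ (6.23)
`L^k_{n+1} ≤ max{H^k_{n-i} - |i| + 1 : i ≥ -1}`.

This file runs `N` consecutive sweeps (`BlockData.blockW`, the sweeps `sweepW` of
`TrackExchangeTransport` at levels `b+N-1, b+N-2, …, b`, the descending track of angle `β_k`
crossing `N` tracks of angle `ξ`, direction `β_k > ξ`) on a clean configuration and an open
walk `W₀`, and proves (`BlockData.blockW_spec`) the invariant `BlockInv`:

* the configuration stays clean for the current weights (`BlockData.D_exchanged_eq`: the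
  exchanged weights of one sweep are the initial weights of the next), the walk stays open with
  pinned endpoints, avoids `⋆`, its labels stay primal (`m + y` even) and of nonnegative height;
* **envelope** (`TrackExchange.Bounded`): every label `(m, y)` of the walk after the sweeps of
  the levels `> J` satisfies `y ≤ h` for some `(m, h) ∈ W₀`, or
  `y ≤ h - (m - r) + 2` for some `(r, h) ∈ W₀` with `r < m` and `m - r ≤ h - J + 1` — GM14's
  `L̃(r, s)^j_m = s - (m - r) + 2` for `r < m ≤ r + s - j + 1` (display after (6.24)); the two
  raising rules close up by a **parity** argument (`Bounded.raise_one`, `Bounded.raise_two`: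
  primal labels have `m + y` even);
* **provenance** (`BlockData.Gen`): every label of the final walk not on `W₀` was generated at
  some sweep `s` from a label `(m', J_s)` of the walk of that time — itself within the envelope
  of level `J_s` — as `(m'+2, J_s)`, `(m'+1, J_s - 1)`, or `(m'+1, J_s + 1)`, the last one only
  together with the detour event `DetourAt` of that sweep at column `m'`.

The lateral containment needed to keep the walk off the boundary columns (GM14 Lemma 6.5,
`D^k`) is `Bounded.abs_le`: within the envelope, `|m| ≤ C + 1` when `W₀` lies in the tent
`|r| + h ≤ C`.

## References

* G. R. Grimmett, I. Manolescu, PTRF 159 (2014) 273–327, arXiv:1204.0505, §6.2: (6.8), Lemma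
  6.5, proof of Lemma 6.6 up to (6.25).
-/

noncomputable section

namespace Literature.Probability.Percolation

open LatticeModels StarTriangle Real MeasureTheory

namespace TrackExchange

/-! ### The envelope predicate -/

/-- **The envelope after the sweeps of the levels `> J`** (GM14's ranges `L^j`, in the
column-additive form (6.25)): the label `(m, y)` is below an original label of its own column,
or below the staircase `h - (m - r) + 2` issued from an original label `(r, h)` to its left,
within the extent `m - r ≤ h - J + 1` reached so far. [cite: GrimmettManolescu2014Isoradial, §6.2 (6.24)–(6.25)] -/
def Bounded (W₀ : List SV) (J m y : ℤ) : Prop :=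
  (∃ h, some (m, h) ∈ W₀ ∧ y ≤ h) ∨
    ∃ r h, some (r, h) ∈ W₀ ∧ r < m ∧ m - r ≤ h - J + 1 ∧ y ≤ h - (m - r) + 2

namespace Bounded

variable {W₀ : List SV}

/-- Original labels are within the envelope. [folklore] -/
theorem of_mem {J m y : ℤ} (h : some (m, y) ∈ W₀) : Bounded W₀ J m y := Or.inl ⟨y, h, le_rfl⟩

/-- The envelope grows as the levels are swept downwards. [folklore] -/
theorem mono {J J' m y : ℤ} (hJ : J' ≤ J) (h : Bounded W₀ J m y) : Bounded W₀ J' m y := by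
  rcases h with h | ⟨r, h, h1, h2, h3, h4⟩
  · exact Or.inl h
  · exact Or.inr ⟨r, h, h1, h2, by omega, h4⟩

/-- The envelope is downward closed in the height. [folklore] -/
theorem of_le {J m y y' : ℤ} (hy : y' ≤ y) (h : Bounded W₀ J m y) : Bounded W₀ J m y' := by
  rcases h with ⟨h, h1, h2⟩ | ⟨r, h, h1, h2, h3, h4⟩
  · exact Or.inl ⟨h, h1, hy.trans h2⟩
  · exact Or.inr ⟨r, h, h1, h2, h3, hy.trans h4⟩

/-- **First raising rule** ("the height in column `n+1` increases to `j+1`"): a primal label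
`(m, J)` within the envelope of level `J` puts `(m+1, J+1)` within the envelope of level `J-1`.
The parity of primal labels is what makes the extent condition close up.
[cite: GrimmettManolescu2014Isoradial, §6.2 (6.24)] -/
theorem raise_one (hpar : ∀ r h, some (r, h) ∈ W₀ → Even (r + h)) {J m : ℤ} (hmJ : Even (m + J))
    (h : Bounded W₀ J m J) : Bounded W₀ (J - 1) (m + 1) (J + 1) := by
  rcases h with ⟨h, h1, h2⟩ | ⟨r, h, h1, h2, h3, h4⟩
  · exact Or.inr ⟨m, h, h1, by omega, by omega, by omega⟩
  · have hp := hpar r h h1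
    have hne : m - r ≠ h - J + 1 := by
      intro he
      obtain ⟨a, ha⟩ := hp; obtain ⟨c, hc⟩ := hmJ
      omega
    exact Or.inr ⟨r, h, h1, by omega, by omega, by omega⟩

/-- **Second raising rule** ("the height in column `n+2` increases to `j`"): a primal label
`(m, J)` within the envelope of level `J` puts `(m+2, J)` within the envelope of level `J-1`.
[cite: GrimmettManolescu2014Isoradial, §6.2 (6.24)] -/
theorem raise_two (hpar : ∀ r h, some (r, h) ∈ W₀ → Even (r + h)) {J m : ℤ} (hmJ : Even (m + J))
    (h : Bounded W₀ J m J) : Bounded W₀ (J - 1) (m + 2) J := by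
  rcases h with ⟨h, h1, h2⟩ | ⟨r, h, h1, h2, h3, h4⟩
  · exact Or.inr ⟨m, h, h1, by omega, by omega, by omega⟩
  · have hp := hpar r h h1
    have hne : m - r ≠ h - J + 1 := by
      intro he
      obtain ⟨a, ha⟩ := hp; obtain ⟨c, hc⟩ := hmJ
      omega
    exact Or.inr ⟨r, h, h1, by omega, by omega, by omega⟩

/-- **Lateral containment** (GM14 Lemma 6.5): if the original walk lies in the tent
`|r| + h ≤ C` (heights `≥ 0`) and `J ≥ 0`, every column within the envelope has `|m| ≤ C + 1`.
[cite: GrimmettManolescu2014Isoradial, §6.2 Lemma 6.5] -/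
theorem abs_le {C J m y : ℤ} (htent : ∀ r h, some (r, h) ∈ W₀ → |r| + h ≤ C ∧ 0 ≤ h) (hJ : 0 ≤ J)
    (h : Bounded W₀ J m y) : |m| ≤ C + 1 := by
  rcases h with ⟨h, h1, -⟩ | ⟨r, h, h1, h2, h3, -⟩
  · have := htent m h h1
    omega
  · have := htent r h h1
    have := le_abs_self r
    have := neg_abs_le r
    rcases abs_cases m with ⟨hm, -⟩ | ⟨hm, -⟩ <;> omega

/-- **Vertical containment**: within the envelope the height is at most `C + 2 - |m|` for the
tent `|r| + h ≤ C`, at every level (so the walk stays in GM14's `D^{k+1}` when it started in `D^k`).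
[cite: GrimmettManolescu2014Isoradial, §6.2 Lemma 6.5] -/
theorem add_abs_le {C J m y : ℤ} (htent : ∀ r h, some (r, h) ∈ W₀ → |r| + h ≤ C ∧ 0 ≤ h)
    (h : Bounded W₀ J m y) : |m| + y ≤ C + 2 := by
  rcases h with ⟨h, h1, h2⟩ | ⟨r, h, h1, h2, h3, h4⟩
  · have := htent m h h1
    omega
  · have := htent r h h1
    have := le_abs_self r
    have := neg_abs_le r
    rcases abs_cases m with ⟨hm, -⟩ | ⟨hm, -⟩ <;> omega

end Bounded

/-! ### The data of a block -/

/-- **Data of one block of track exchanges** `U = Σ_b ∘ ⋯ ∘ Σ_{b+N-1}` (GM14 (6.8), where the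
block `U_k` has lowest level `b = k`): half-width `M`, column angles `α`, the row angles `base` of
all tracks other than the descending one (the levels `b-1, …, b+N-1` carrying the regular angle
`ξ`), the descending track's angle `βk > ξ`, the lowest level `b`, and the number `N` of sweeps.
[cite: GrimmettManolescu2014Isoradial, §6.2 (6.8)] -/
structure BlockData where
  /-- Half-width of the strip. -/
  M : ℕ
  /-- Transverse angles of the column tracks. -/
  α : ℤ → ℝ
  /-- Row angles with the descending track removed. -/
  base : ℤ → ℝ
  /-- Angle of the descending track (`β_k`). -/
  βk : ℝ
  /-- The regular angle (`ξ`). -/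
  ξ : ℝ
  /-- The lowest level swept. -/
  b : ℤ
  /-- The number of sweeps. -/
  N : ℕ

namespace BlockData

variable (B : BlockData)

/-- The level of the `s`-th sweep (`s = 0, …, N-1`): `b + N - 1 - s`. [cite: GrimmettManolescu2014Isoradial, §6.2 (6.8)] -/
def level (s : ℕ) : ℤ := B.b + B.N - 1 - s

/-- The row angles before the `s`-th sweep: the descending track sits at level `level s`.
[cite: GrimmettManolescu2014Isoradial, §6.2] -/
def rowβ (s : ℕ) (y : ℤ) : ℝ := if y = B.level s then B.βk else B.base y

/-- The exchange data of the `s`-th sweep. [cite: GrimmettManolescu2014Isoradial, §6.2] -/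
def D (s : ℕ) : ExchangeData := { M := B.M, α := B.α, β := B.rowβ s, j := B.level s }

/-- Hypotheses of a block: direction `βk > ξ`, bounded angles on the strip, the levels
`b-1, …, b+N-1` regular, and `b ≥ 1` (the walk's endpoints, at height `0`, are never in a middle
row). [cite: GrimmettManolescu2014Isoradial, §6.2] -/
structure Valid : Prop where
  /-- direction of all the sweeps of the block -/
  dir : B.βk - B.ξ ∈ Set.Ioo 0 π
  /-- bounded angles, regular tracks -/
  lo : ∀ i : ℤ, -(B.M : ℤ) ≤ i → i < B.M → B.ξ - B.α i ∈ Set.Ioo 0 π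
  /-- bounded angles, descending track -/
  up : ∀ i : ℤ, -(B.M : ℤ) ≤ i → i < B.M → B.βk - B.α i ∈ Set.Ioo 0 π
  /-- the block of regular tracks -/
  base_eq : ∀ y, B.b - 1 ≤ y → y ≤ B.b + B.N - 1 → B.base y = B.ξ
  /-- the lowest level is at least `1` -/
  one_le_b : 1 ≤ B.b

/-- Unfolding. [folklore] -/
@[simp] theorem D_M (s : ℕ) : (B.D s).M = B.M := rfl
/-- Unfolding. [folklore] -/
@[simp] theorem D_α (s : ℕ) : (B.D s).α = B.α := rfl
/-- Unfolding. [folklore] -/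
@[simp] theorem D_β (s : ℕ) : (B.D s).β = B.rowβ s := rfl
/-- Unfolding. [folklore] -/
@[simp] theorem D_j (s : ℕ) : (B.D s).j = B.level s := rfl
/-- Unfolding. [folklore] -/
@[simp] theorem D_up (s : ℕ) : (B.D s).up = B.βk := by
  simp [ExchangeData.up, rowβ]
/-- Unfolding. [folklore] -/
theorem D_lo {s : ℕ} (hB : B.Valid) (hs : s < B.N) : (B.D s).lo = B.ξ := by
  simp only [ExchangeData.lo, D_β, D_j, rowβ, level]
  rw [if_neg (by omega), hB.base_eq _ (by omega) (by omega)]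

/-- Every sweep of a valid block is a valid exchange. [cite: GrimmettManolescu2014Isoradial, §6.2] -/
theorem D_valid (hB : B.Valid) {s : ℕ} (hs : s < B.N) : (B.D s).Valid := by
  refine ⟨?_, fun i hi hi' => ?_, fun i hi hi' => ?_⟩
  · rw [D_up, B.D_lo hB hs]; exact hB.dir
  · rw [B.D_lo hB hs]; exact hB.lo i hi hi'
  · rw [D_up]; exact hB.up i hi hi'

/-- The next sweep starts from the row angles left by the previous one. [cite: GrimmettManolescu2014Isoradial, §6.2] -/
theorem rowβ_succ (hB : B.Valid) {s : ℕ} (hs : s < B.N) :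
    B.rowβ (s + 1) = B.rowβ s ∘ Equiv.swap (B.level s - 1) (B.level s) := by
  funext y
  have hl : B.level (s + 1) = B.level s - 1 := by simp only [level]; push_cast; ring
  have hb1 : B.base (B.level s) = B.ξ := hB.base_eq _ (by simp only [level]; omega) (by simp only [level]; omega)
  have hb2 : B.base (B.level s - 1) = B.ξ := hB.base_eq _ (by simp only [level]; omega) (by simp only [level]; omega)
  simp only [Function.comp_apply, rowβ, hl]
  by_cases h1 : y = B.level s - 1
  · rw [if_pos h1, h1, Equiv.swap_apply_left, if_pos rfl]
  · rw [if_neg h1]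
    by_cases h2 : y = B.level s
    · have hne1 : ¬ (B.level s = B.level s - 1) := by omega
      have hne2 : ¬ (B.level s - 1 = B.level s) := by omega
      rw [h2, Equiv.swap_apply_right]
      simp only [hne2, if_false, hb1, hb2]
    · rw [Equiv.swap_apply_of_ne_of_ne h1 h2, if_neg h2]

/-- **The exchanged weights of one sweep are the initial weights of the next.**
[cite: GrimmettManolescu2014Isoradial, §5.3] -/
theorem D_exchanged_eq (hB : B.Valid) {s : ℕ} (hs : s < B.N) : (B.D s).exchanged = (B.D (s + 1)).initial := by
  simp only [ExchangeData.exchanged, ExchangeData.initial, ExchangeData.βExchanged, D_β, D_α, D_M, D_j]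
  rw [B.rowβ_succ hB hs]

/-! ### The block acting on (configuration, walk) -/

/-- The randomness of one sweep of the block. [folklore] -/
abbrev Noise : Type := unitInterval × (Fin (2 * B.M) → unitInterval)

/-- **The first `n` sweeps of the block** on a configuration and a walk, fed with the noise
`r 0, …, r (n-1)`. [cite: GrimmettManolescu2014Isoradial, §6.2 (6.8)] -/
def blockW (r : ℕ → B.Noise) : ℕ → ExchangeData.WState → ExchangeData.WState
  | 0, x => x
  | n + 1, x => (B.D n).sweepW (blockW r n x) (r n)

/-- No sweep: nothing happens. [folklore] -/
@[simp] theorem blockW_zero (r : ℕ → B.Noise) (x : ExchangeData.WState) : B.blockW r 0 x = x := rfl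

/-- One more sweep. [folklore] -/
theorem blockW_succ (r : ℕ → B.Noise) (n : ℕ) (x : ExchangeData.WState) :
    B.blockW r (n + 1) x = (B.D n).sweepW (B.blockW r n x) (r n) := rfl

/-- **Generation at sweep `s`** of a label `z` (GM14 Fig. 5.5 blue vertices, in envelope form):
from a primal label `(m', J_s)` of the walk of that time, itself within the envelope of level
`J_s`, as `(m'+2, J_s)`, `(m'+1, J_s - 1)`, or `(m'+1, J_s + 1)` with the detour event.
[cite: GrimmettManolescu2014Isoradial, §6.2] -/
def Gen (W₀ : List SV) (r : ℕ → B.Noise) (s : ℕ) (z : SV) : Prop :=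
  ∃ m y : ℤ, z = some (m, y) ∧
    ((y = B.level s ∧ Bounded W₀ (B.level s) (m - 2) (B.level s) ∧ Even (m - 2 + B.level s)) ∨
     (y = B.level s - 1 ∧ Bounded W₀ (B.level s) (m - 1) (B.level s) ∧ Even (m - 1 + B.level s)) ∨
     (y = B.level s + 1 ∧ Bounded W₀ (B.level s) (m - 1) (B.level s) ∧ Even (m - 1 + B.level s) ∧
        (B.D s).DetourAt (r s).2 (m - 1)))

/-- The invariant after `n` sweeps of the block. [cite: GrimmettManolescu2014Isoradial, §6.2] -/
structure BlockInv (W₀ : List SV) (P₀ P₁ : SV) (r : ℕ → B.Noise) (n : ℕ) (x : ExchangeData.WState) : Prop where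
  /-- clean for the current weights -/
  clean : Clean (B.D n).initial x.1
  /-- the walk is open -/
  walk : IsWalk x.1 x.2
  /-- first endpoint -/
  head : x.2.head? = some P₀
  /-- last endpoint -/
  last : x.2.getLast? = some P₁
  /-- the walk avoids `⋆` -/
  none_not_mem : none ∉ x.2
  /-- labels are primal -/
  parity : ∀ m y, some (m, y) ∈ x.2 → Even (m + y)
  /-- heights are nonnegative -/
  nonneg : ∀ m y, some (m, y) ∈ x.2 → 0 ≤ y
  /-- the envelope -/
  bound : ∀ m y, some (m, y) ∈ x.2 → Bounded W₀ (B.level n) m y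
  /-- provenance -/
  prov : ∀ z ∈ x.2, z ∈ W₀ ∨ ∃ s, s < n ∧ B.Gen W₀ r s z

variable {B}

/-- **One more sweep preserves the block invariant.** [cite: GrimmettManolescu2014Isoradial, §6.2] -/
theorem BlockInv.succ (hB : B.Valid) {W₀ : List SV} {P₀ P₁ : SV} {r : ℕ → B.Noise}
    (hP₀ : ∃ x₀ : ℤ, P₀ = some (x₀, 0)) (hP₁ : ∃ x₁ : ℤ, P₁ = some (x₁, 0))
    (hpar₀ : ∀ m h, some (m, h) ∈ W₀ → Even (m + h)) {C : ℤ}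
    (htent : ∀ m h, some (m, h) ∈ W₀ → |m| + h ≤ C ∧ 0 ≤ h) (hM : C + 3 ≤ B.M) (hb : 0 ≤ B.b)
    {n : ℕ} (hn : n < B.N) {x : ExchangeData.WState} (h : B.BlockInv W₀ P₀ P₁ r n x) :
    B.BlockInv W₀ P₀ P₁ r (n + 1) ((B.D n).sweepW x (r n)) := by
  obtain ⟨x₀, rfl⟩ := hP₀
  obtain ⟨x₁, rfl⟩ := hP₁
  have hV := B.D_valid hB hn
  have hJ0 : 0 ≤ B.level n := by simp only [level]; omega
  have hJ1 : 1 ≤ B.level n := by have := hB.one_le_b; simp only [level]; omega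
  have hmid : ∀ (x' : ℤ) (i : ℤ), (some (x', (0 : ℤ)) : SV) ≠ (B.D n).mid i := by
    intro x' i h'
    simp only [ExchangeData.mid, D_j, Option.some.injEq, Prod.mk.injEq] at h'
    omega
  have hcol : ∀ m y, some (m, y) ∈ x.2 → -((B.D n).M : ℤ) < m ∧ m < ((B.D n).M : ℤ) - 1 := by
    intro m y hm
    have h1 := (h.bound m y hm).abs_le htent hJ0
    rw [_root_.abs_le] at h1
    simp only [D_M]
    omega
  obtain ⟨hc, hw, hh, hl, hnn, hprov⟩ := ExchangeData.sweepW_spec hV (by simp) (hmid x₀) (by simp) (hmid x₁)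
    h.clean h.walk h.head h.last h.none_not_mem hcol (r n)
  have hlev : B.level (n + 1) = B.level n - 1 := by simp only [level]; push_cast; ring
  -- the new labels
  have hnew : ∀ m y, some (m, y) ∈ ((B.D n).sweepW x (r n)).2 → some (m, y) ∈ x.2 ∨
      ((y = B.level n ∧ some (m - 2, B.level n) ∈ x.2) ∨ (y = B.level n - 1 ∧ some (m - 1, B.level n) ∈ x.2) ∨
        (y = B.level n + 1 ∧ some (m - 1, B.level n) ∈ x.2 ∧ (B.D n).DetourAt (r n).2 (m - 1))) := by
    intro m y hm
    rcases hprov _ hm with hm | ⟨m', y', he, hg⟩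
    · exact Or.inl hm
    · simp only [Option.some.injEq, Prod.mk.injEq] at he
      obtain ⟨rfl, rfl⟩ := he
      exact Or.inr hg
  refine ⟨?_, hw, hh, hl, hnn, ?_, ?_, ?_, ?_⟩
  · rw [← B.D_exchanged_eq hB hn]; exact hc
  · intro m y hm
    rcases hnew m y hm with hm' | ⟨hy, hg⟩ | ⟨hy, hg⟩ | ⟨hy, hg, -⟩
    · exact h.parity m y hm'
    · have := h.parity _ _ hg; obtain ⟨c, hc⟩ := this; exact ⟨c + 1, by omega⟩
    · have := h.parity _ _ hg; obtain ⟨c, hc⟩ := this; exact ⟨c, by omega⟩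
    · have := h.parity _ _ hg; obtain ⟨c, hc⟩ := this; exact ⟨c + 1, by omega⟩
  · intro m y hm
    rcases hnew m y hm with hm' | ⟨hy, -⟩ | ⟨hy, -⟩ | ⟨hy, -, -⟩
    · exact h.nonneg m y hm'
    all_goals omega
  · intro m y hm
    rw [hlev]
    rcases hnew m y hm with hm' | ⟨hy, hg⟩ | ⟨hy, hg⟩ | ⟨hy, hg, -⟩
    · exact (h.bound m y hm').mono (by omega)
    · have := (h.bound _ _ hg).raise_two hpar₀ (h.parity _ _ hg)
      rw [sub_add_cancel] at this
      rw [hy]; exact this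
    · have := (h.bound _ _ hg).raise_one hpar₀ (h.parity _ _ hg)
      rw [sub_add_cancel] at this
      rw [hy]; exact this.of_le (by omega)
    · have := (h.bound _ _ hg).raise_one hpar₀ (h.parity _ _ hg)
      rw [sub_add_cancel] at this
      rw [hy]; exact this
  · intro z hz
    rcases hprov z hz with hz' | ⟨m, y, rfl, hg⟩
    · rcases h.prov z hz' with h' | ⟨s, hs, hg⟩
      · exact Or.inl h'
      · exact Or.inr ⟨s, by omega, hg⟩
    · right
      refine ⟨n, by omega, m, y, rfl, ?_⟩
      simp only [D_j] at hg
      rcases hg with ⟨hy, hm⟩ | ⟨hy, hm⟩ | ⟨hy, hm, hd⟩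
      · exact Or.inl ⟨hy, h.bound _ _ hm, h.parity _ _ hm⟩
      · exact Or.inr (Or.inl ⟨hy, h.bound _ _ hm, h.parity _ _ hm⟩)
      · exact Or.inr (Or.inr ⟨hy, h.bound _ _ hm, h.parity _ _ hm, hd⟩)

/-- **The block, pathwise** (GM14 §6.2, proof of Lemma 6.6 up to (6.25), and Lemma 6.5): started
from a configuration clean for the initial weights and an open primal walk `W₀` with endpoints at
height `0`, lying in the tent `|m| + y ≤ C` with `C + 3 ≤ M`, after the `N` sweeps the
configuration is clean for the final weights and the walk is open, with the same endpoints,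
avoiding `⋆`, primal, of nonnegative heights, within the envelope of level `b - 1`, and every
label of it is original or generated at some sweep. [cite: GrimmettManolescu2014Isoradial, §6.2] -/
theorem blockW_spec (hB : B.Valid) {W₀ : List SV} {P₀ P₁ : SV} (r : ℕ → B.Noise)
    (hP₀ : ∃ x₀ : ℤ, P₀ = some (x₀, 0)) (hP₁ : ∃ x₁ : ℤ, P₁ = some (x₁, 0))
    (hpar₀ : ∀ m h, some (m, h) ∈ W₀ → Even (m + h)) {C : ℤ}
    (htent : ∀ m h, some (m, h) ∈ W₀ → |m| + h ≤ C ∧ 0 ≤ h) (hM : C + 3 ≤ B.M) (hb : 0 ≤ B.b)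
    {ω : Set (Sym2 SV)} (hC : Clean (B.D 0).initial ω) (hW : IsWalk ω W₀) (hh : W₀.head? = some P₀)
    (hl : W₀.getLast? = some P₁) (hn : none ∉ W₀) :
    ∀ n ≤ B.N, B.BlockInv W₀ P₀ P₁ r n (B.blockW r n (ω, W₀)) := by
  intro n
  induction n with
  | zero =>
    intro _
    exact ⟨hC, hW, hh, hl, hn, hpar₀, fun m y hm => (htent m y hm).2, fun m y hm => Bounded.of_mem hm,
      fun z hz => Or.inl hz⟩
  | succ n ih =>
    intro hn'
    rw [blockW_succ]
    exact (ih (by omega)).succ hB hP₀ hP₁ hpar₀ htent hM hb (by omega)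

/-- The configuration component of the block does not depend on the walk. [folklore] -/
theorem blockW_fst (r : ℕ → B.Noise) : ∀ (n : ℕ) (x : ExchangeData.WState),
    (B.blockW r n x).1 = (B.blockW r n (x.1, [])).1
  | 0, _ => rfl
  | n + 1, x => by
    rw [blockW_succ, blockW_succ, ExchangeData.sweepW_fst, ExchangeData.sweepW_fst, blockW_fst r n x]

end BlockData

end TrackExchange

end Literature.Probability.Percolation
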